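import Mathlib
import Literature.Barriers.PneNP.ExtendedFormulationFaceCounting
import Summits.ValiantsHypothesis.ValiantsHypothesis.Theorems.FifoMatchingNFPolytopeQueueGridFaceDefs
import HarnessLib

/-!
# Route FifoMatching — crux `NNDivisionHard` (stmt-ValiantsHypothesis-21181), hyper-degree tier:
# the witness of Hrubeš–Yehudayoff 2021, Thm 30 (file 1 of 2: support invariants and vertices)

What is OPEN in `NNDivisionHard` (and in stub B2 of line `division_split` of `NNNotVP`, stmt-11615)
is the HYPER-DEGREE tier of cofactors (`NNDivisionHard.HyperDegree.nnDivisionHard_iff_hyperDegree`);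
the tier `deg h ≤ 2^⌊n^{1/8}⌋` was closed by counting vertices of planar shadows of Newton polytopes
(`GridCorShadow.expRung_holds`: HY21 Thm 42 for FORMULAS + BCS balancing, whose `log deg` factor is
the origin of the degree cap).  This file and its sequel `…ShadowCap.lean` put HY21 **Theorem 30**
in the kernel — a bivariate monotone polynomial of circuit complexity `O(n²)` whose Newton polygon
has `2^n + 1` vertices — i.e. the vertex count of planar shadows has NO degree-free circuit form.

This file treats any two-track sequence `P, Q : ℕ → ℝ≥0[x, y]` obeying the repeated-squaring
recursion of HY21 §8 written at final scale `n` (the substitution `(x,y) ↦ (x²,y⁴)` pre-applied, and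
`P` carrying one extra parabola point so that the `Q`-track needs no correction monomial):
`P₀ = 1 + x^{2^n} y^{4^n}`, `Q₀ = 1`, `P_{m+1} = P_m² + x^{2^n} y^{2^{2n-m-1}} Q_m²`, `Q_{m+1} = P_m Q_m`.
* `inv_of_rec` — HY21 Lemma 53 in the units `(2^n, 2^{2n-m})`: `supp P_m ∋ (k, k²)` (`k ≤ 2^m`) and
  `⊆ {s ≥ r²}`; `supp Q_m ∋ (k, k²+k)` (`k < 2^m`) and `⊆ {s ≥ r² + r}` (integrality step
  `(r₁ - r₂)² ≥ r₁ - r₂`); no cancellation over `ℝ≥0`.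
* ★ `key_mem_extremePoints_of_rec`, `vertices_of_rec` — the `2^n + 1` parabola points
  `(2^n k, 2^n k²)` are exposed (functional `2k·a - b`), so `Newt(P_n)` has `≥ 2^n + 1` vertices.
The sequel proves `L₊(P_n) ≤ 6(n+1)(n+2)` (one straight-line program for both tracks), constructs the
sequences, and draws the census corollaries.

Honest framing: a NEGATIVE calibration tool for the hyper-degree tier (published theorem, kernel
form), not progress on the crux; `NNDivisionHard`, `NNNotVP`, `VP ≠ VNP` remain OPEN (NOT proved).
No definitions, no named facts.

References: P. Hrubeš, A. Yehudayoff, *Shadows of Newton polytopes*, CCC 2021 (LIPIcs 200:9), Thm 30,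
Lemma 53, §8 [HrubesYehudayoff2021]; M. Goemans, *Smallest compact formulation for the permutahedron*,
Math. Prog. 153 (2015) §2 (strict linear preference ⇒ vertex) [Goemans2015].
-/

noncomputable section

-- Sub = Summit single-conjunct layout: the duplicated namespace component is mandated by the tree.
set_option linter.dupNamespace false
set_option autoImplicit false

namespace Summit.ValiantsHypothesis.ValiantsHypothesis.Theorems.FifoMatching.NNDivisionHard.ShadowCap

open MvPolynomial
open Finsupp (single)
open scoped NNReal
open Summit.ValiantsHypothesis.ValiantsHypothesis.Theorems.FifoMatching.QueueGridFace (realOf suppPts)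

/-! ## Exponent vectors `(a, b) = single 0 a + single 1 b` of bivariate monomials -/

/-- first coordinate. [folklore] -/
@[simp] theorem sv_zero (a b : ℕ) : (single 0 a + single 1 b : Fin 2 →₀ ℕ) 0 = a := by
  simp

/-- second coordinate. [folklore] -/
@[simp] theorem sv_one (a b : ℕ) : (single 0 a + single 1 b : Fin 2 →₀ ℕ) 1 = b := by
  simp

/-- addition of exponent vectors. [folklore] -/
theorem sv_add (a b a' b' : ℕ) :
    (single 0 a + single 1 b : Fin 2 →₀ ℕ) + (single 0 a' + single 1 b') =
      single 0 (a + a') + single 1 (b + b') := by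
  ext i
  fin_cases i <;> simp [Finsupp.add_apply]

/-- every exponent vector in two variables has this form. [folklore] -/
theorem eq_sv (d : Fin 2 →₀ ℕ) : d = single 0 (d 0) + single 1 (d 1) := by
  ext i
  fin_cases i <;> simp

/-! ## No cancellation over `ℝ≥0`: coefficient and support bookkeeping -/

/-- a sum with a nonzero left coefficient has a nonzero coefficient (no cancellation in `ℝ≥0`). [folklore] -/
theorem coeff_add_ne_zero_left {f g : MvPolynomial (Fin 2) ℝ≥0} {d : Fin 2 →₀ ℕ} (hf : coeff d f ≠ 0) :
    coeff d (f + g) ≠ 0 := by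
  rw [coeff_add]
  intro h
  exact hf (le_antisymm (le_of_le_of_eq le_self_add h) bot_le)

/-- a sum with a nonzero right coefficient has a nonzero coefficient. [folklore] -/
theorem coeff_add_ne_zero_right {f g : MvPolynomial (Fin 2) ℝ≥0} {d : Fin 2 →₀ ℕ} (hg : coeff d g ≠ 0) :
    coeff d (f + g) ≠ 0 := by
  rw [add_comm]
  exact coeff_add_ne_zero_left hg

/-- products of nonzero coefficients survive in the product (positivity of `ℝ≥0`). [folklore] -/
theorem coeff_mul_ne_zero {f g : MvPolynomial (Fin 2) ℝ≥0} {d e : Fin 2 →₀ ℕ} (hf : coeff d f ≠ 0)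
    (hg : coeff e g ≠ 0) : coeff (d + e) (f * g) ≠ 0 := by
  classical
  rw [coeff_mul]
  intro h
  have h' := Finset.sum_eq_zero_iff.1 h (d, e) (by simp)
  exact mul_ne_zero hf hg h'

/-- the support of a product lies in the sumset of the supports. [folklore] -/
theorem exists_of_mem_support_mul {f g : MvPolynomial (Fin 2) ℝ≥0} {d : Fin 2 →₀ ℕ}
    (h : d ∈ (f * g).support) : ∃ d₁ ∈ f.support, ∃ d₂ ∈ g.support, d₁ + d₂ = d := by
  classical
  exact Finset.mem_add.1 (support_mul f g h)

/-- the support of a sum lies in the union of the supports. [folklore] -/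
theorem mem_support_add {f g : MvPolynomial (Fin 2) ℝ≥0} {d : Fin 2 →₀ ℕ} (h : d ∈ (f + g).support) :
    d ∈ f.support ∨ d ∈ g.support := by
  classical
  exact Finset.mem_union.1 (support_add h)

/-- the support of `x^e · g` is the shifted support of `g`. [folklore] -/
theorem exists_of_mem_support_monomial_mul {g : MvPolynomial (Fin 2) ℝ≥0} {e d : Fin 2 →₀ ℕ}
    (h : d ∈ (monomial e (1 : ℝ≥0) * g).support) : ∃ d₂ ∈ g.support, e + d₂ = d := by
  obtain ⟨d₁, hd₁, d₂, hd₂, rfl⟩ := exists_of_mem_support_mul h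
  have h1 : d₁ = e := Finset.mem_singleton.1 (support_monomial_subset hd₁)
  exact ⟨d₂, hd₂, by rw [h1]⟩

/-- the support of a monomial. [folklore] -/
theorem eq_of_mem_support_monomial {e d : Fin 2 →₀ ℕ}
    (h : d ∈ (monomial e (1 : ℝ≥0) : MvPolynomial (Fin 2) ℝ≥0).support) : d = e :=
  Finset.mem_singleton.1 (support_monomial_subset h)

/-- the support of `1`. [folklore] -/
theorem eq_of_mem_support_one {d : Fin 2 →₀ ℕ} (h : d ∈ (1 : MvPolynomial (Fin 2) ℝ≥0).support) :
    d = 0 := by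
  have h' : d ∈ (monomial (0 : Fin 2 →₀ ℕ) (1 : ℝ≥0) : MvPolynomial (Fin 2) ℝ≥0).support := by
    simpa using h
  exact Finset.mem_singleton.1 (support_monomial_subset h')

/-! ## The support invariants of the two-track recursion (HY21 Lemma 53, units `(2^n, 2^(2n-m))`) -/

/-- **The invariant of level `m ≤ n`** for any two-track sequence obeying the repeated-squaring
recursion `P₀ = 1 + x^{2^n}y^{4^n}`, `Q₀ = 1`, `P_{m+1} = P_m² + x^{2^n}y^{2^{2n-m-1}} Q_m²`,
`Q_{m+1} = P_m Q_m`.  Keys: `P_m ∋ (2^n k, 2^{2n-m} k²)` for `k ≤ 2^m`, `Q_m ∋ (2^n k, 2^{2n-m}(k²+k))`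
for `k < 2^m`; regions: every support point of `P_m` is `(2^n r, 2^{2n-m} s)` with `r² ≤ s`, of `Q_m`
with `r² + r ≤ s`. [cite: HrubesYehudayoff2021, Lemma 53 and §8 (11)] -/
theorem inv_of_rec (n : ℕ) (P Q : ℕ → MvPolynomial (Fin 2) ℝ≥0)
    (hP0 : P 0 = 1 + monomial (single 0 (2 ^ n) + single 1 (2 ^ (2 * n))) 1) (hQ0 : Q 0 = 1)
    (hPs : ∀ m, P (m + 1) = P m * P m +
      monomial (single 0 (2 ^ n) + single 1 (2 ^ (2 * n - m - 1))) 1 * (Q m * Q m))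
    (hQs : ∀ m, Q (m + 1) = P m * Q m) : ∀ m, m ≤ n →
    (∀ k, k ≤ 2 ^ m → coeff (single 0 (2 ^ n * k) + single 1 (2 ^ (2 * n - m) * k ^ 2)) (P m) ≠ 0) ∧
    (∀ k, k < 2 ^ m →
      coeff (single 0 (2 ^ n * k) + single 1 (2 ^ (2 * n - m) * (k ^ 2 + k))) (Q m) ≠ 0) ∧
    (∀ d ∈ (P m).support, ∃ r s : ℕ, d 0 = 2 ^ n * r ∧ d 1 = 2 ^ (2 * n - m) * s ∧ r ^ 2 ≤ s) ∧
    (∀ d ∈ (Q m).support, ∃ r s : ℕ, d 0 = 2 ^ n * r ∧ d 1 = 2 ^ (2 * n - m) * s ∧ r ^ 2 + r ≤ s) := by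
  intro m
  induction m with
  | zero =>
    intro _
    refine ⟨?_, ?_, ?_, ?_⟩
    · intro k hk
      rw [hP0]
      interval_cases k
      · have h0 : (single 0 (2 ^ n * 0) + single 1 (2 ^ (2 * n - 0) * 0 ^ 2) : Fin 2 →₀ ℕ) = 0 := by
          ext i; fin_cases i <;> simp
        rw [h0]
        exact coeff_add_ne_zero_left (by simp)
      · have h1 : (single 0 (2 ^ n * 1) + single 1 (2 ^ (2 * n - 0) * 1 ^ 2) : Fin 2 →₀ ℕ) =
            single 0 (2 ^ n) + single 1 (2 ^ (2 * n)) := by simp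
        rw [h1]
        exact coeff_add_ne_zero_right (by simp)
    · intro k hk
      have hk0 : k = 0 := by omega
      subst hk0
      simp [hQ0]
    · intro d hd
      rw [hP0] at hd
      rcases mem_support_add hd with h | h
      · refine ⟨0, 0, ?_, ?_, by norm_num⟩ <;> simp [eq_of_mem_support_one h]
      · refine ⟨1, 1, ?_, ?_, by norm_num⟩ <;> simp [eq_of_mem_support_monomial h]
    · intro d hd
      rw [hQ0] at hd
      refine ⟨0, 0, ?_, ?_, by norm_num⟩ <;> simp [eq_of_mem_support_one hd]
  | succ m ih =>
    intro hm
    obtain ⟨hKP, hKQ, hRP, hRQ⟩ := ih (Nat.le_of_succ_le hm)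
    -- the unit of level `m` is twice the unit of level `m + 1`
    have hunit : 2 ^ (2 * n - m) = 2 * 2 ^ (2 * n - (m + 1)) := by
      rw [← pow_succ']
      congr 1
      omega
    have hunit' : 2 ^ (2 * n - m - 1) = 2 ^ (2 * n - (m + 1)) := by
      congr 1
    refine ⟨?_, ?_, ?_, ?_⟩
    · -- keys of `P_{m+1}`
      intro k hk
      rw [hPs]
      obtain ⟨r, hr | hr⟩ := Nat.even_or_odd' k
      · -- even key `k = 2r`: from `P_m²`
        subst hr
        have hr' : r ≤ 2 ^ m := by rw [pow_succ] at hk; omega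
        have hkey : (single 0 (2 ^ n * (2 * r)) + single 1 (2 ^ (2 * n - (m + 1)) * (2 * r) ^ 2) :
              Fin 2 →₀ ℕ) =
            (single 0 (2 ^ n * r) + single 1 (2 ^ (2 * n - m) * r ^ 2)) +
              (single 0 (2 ^ n * r) + single 1 (2 ^ (2 * n - m) * r ^ 2)) := by
          rw [sv_add, hunit]
          congr 1 <;> ring
        rw [hkey]
        exact coeff_add_ne_zero_left (coeff_mul_ne_zero (hKP r hr') (hKP r hr'))
      · -- odd key `k = 2r + 1`: from `x^{2^n} y^{2^(2n-m-1)} Q_m²`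
        subst hr
        have hr' : r < 2 ^ m := by rw [pow_succ] at hk; omega
        have hkey : (single 0 (2 ^ n * (2 * r + 1)) +
              single 1 (2 ^ (2 * n - (m + 1)) * (2 * r + 1) ^ 2) : Fin 2 →₀ ℕ) =
            (single 0 (2 ^ n) + single 1 (2 ^ (2 * n - m - 1))) +
              ((single 0 (2 ^ n * r) + single 1 (2 ^ (2 * n - m) * (r ^ 2 + r))) +
                (single 0 (2 ^ n * r) + single 1 (2 ^ (2 * n - m) * (r ^ 2 + r)))) := by
          rw [sv_add, sv_add, hunit, hunit']
          congr 1 <;> ring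
        rw [hkey]
        refine coeff_add_ne_zero_right ?_
        rw [coeff_monomial_mul, one_mul]
        exact coeff_mul_ne_zero (hKQ r hr') (hKQ r hr')
    · -- keys of `Q_{m+1} = P_m Q_m`
      intro k hk
      rw [hQs]
      obtain ⟨r, hr | hr⟩ := Nat.even_or_odd' k
      · subst hr
        have hr' : r < 2 ^ m := by rw [pow_succ] at hk; omega
        have hkey : (single 0 (2 ^ n * (2 * r)) +
              single 1 (2 ^ (2 * n - (m + 1)) * ((2 * r) ^ 2 + 2 * r)) : Fin 2 →₀ ℕ) =
            (single 0 (2 ^ n * r) + single 1 (2 ^ (2 * n - m) * r ^ 2)) +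
              (single 0 (2 ^ n * r) + single 1 (2 ^ (2 * n - m) * (r ^ 2 + r))) := by
          rw [sv_add, hunit]
          congr 1 <;> ring
        rw [hkey]
        exact coeff_mul_ne_zero (hKP r hr'.le) (hKQ r hr')
      · subst hr
        have hr' : r < 2 ^ m := by rw [pow_succ] at hk; omega
        have hr1 : r + 1 ≤ 2 ^ m := hr'
        have hkey : (single 0 (2 ^ n * (2 * r + 1)) +
              single 1 (2 ^ (2 * n - (m + 1)) * ((2 * r + 1) ^ 2 + (2 * r + 1))) : Fin 2 →₀ ℕ) =
            (single 0 (2 ^ n * (r + 1)) + single 1 (2 ^ (2 * n - m) * (r + 1) ^ 2)) +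
              (single 0 (2 ^ n * r) + single 1 (2 ^ (2 * n - m) * (r ^ 2 + r))) := by
          rw [sv_add, hunit]
          congr 1 <;> ring
        rw [hkey]
        exact coeff_mul_ne_zero (hKP (r + 1) hr1) (hKQ r hr')
    · -- region of `P_{m+1}`
      intro d hd
      rw [hPs] at hd
      rcases mem_support_add hd with h | h
      · obtain ⟨d₁, hd₁, d₂, hd₂, rfl⟩ := exists_of_mem_support_mul h
        obtain ⟨r₁, s₁, h10, h11, hrs₁⟩ := hRP d₁ hd₁
        obtain ⟨r₂, s₂, h20, h21, hrs₂⟩ := hRP d₂ hd₂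
        refine ⟨r₁ + r₂, 2 * (s₁ + s₂), ?_, ?_, ?_⟩
        · simp only [Finsupp.add_apply, h10, h20]; ring
        · simp only [Finsupp.add_apply, h11, h21, hunit]; ring
        · nlinarith [sq_nonneg (r₁ - r₂ : ℤ), sq_nonneg (r₁ + r₂ : ℤ)]
      · obtain ⟨d₂, hd₂, rfl⟩ := exists_of_mem_support_monomial_mul h
        obtain ⟨e₁, he₁, e₂, he₂, rfl⟩ := exists_of_mem_support_mul hd₂
        obtain ⟨r₁, s₁, h10, h11, hrs₁⟩ := hRQ e₁ he₁
        obtain ⟨r₂, s₂, h20, h21, hrs₂⟩ := hRQ e₂ he₂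
        refine ⟨1 + r₁ + r₂, 1 + 2 * (s₁ + s₂), ?_, ?_, ?_⟩
        · rw [Finsupp.add_apply, sv_zero, Finsupp.add_apply, h10, h20]; ring
        · rw [Finsupp.add_apply, sv_one, Finsupp.add_apply, h11, h21, hunit, hunit']; ring
        · nlinarith [sq_nonneg (r₁ - r₂ : ℤ), sq_nonneg (r₁ + r₂ : ℤ)]
    · -- region of `Q_{m+1}`
      intro d hd
      rw [hQs] at hd
      obtain ⟨d₁, hd₁, d₂, hd₂, rfl⟩ := exists_of_mem_support_mul hd
      obtain ⟨r₁, s₁, h10, h11, hrs₁⟩ := hRP d₁ hd₁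
      obtain ⟨r₂, s₂, h20, h21, hrs₂⟩ := hRQ d₂ hd₂
      refine ⟨r₁ + r₂, 2 * (s₁ + s₂), ?_, ?_, ?_⟩
      · simp only [Finsupp.add_apply, h10, h20]; ring
      · simp only [Finsupp.add_apply, h11, h21, hunit]; ring
      · -- integrality: `(r₁ - r₂)² ≥ r₁ - r₂`
        rcases le_or_gt r₁ r₂ with hle | hlt
        · obtain ⟨t, rfl⟩ := Nat.exists_eq_add_of_le hle
          nlinarith [sq_nonneg (t : ℤ)]
        · obtain ⟨t, rfl⟩ := Nat.exists_eq_add_of_lt hlt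
          nlinarith [sq_nonneg (t : ℤ)]

/-! ## The vertices: the parabola points are exposed -/

/-- **every key point `(2^n k, 2^n k²)`, `k ≤ 2^n`, is an extreme point of the Newton polygon of `P_n`**
(exposed by the functional `(a, b) ↦ 2k·a - b`: strict convexity of the parabola `2^n b = a²` on the
lattice). [cite: HrubesYehudayoff2021, §8 (proof of Thm 30)] -/
theorem key_mem_extremePoints_of_rec (n : ℕ) (P Q : ℕ → MvPolynomial (Fin 2) ℝ≥0)
    (hP0 : P 0 = 1 + monomial (single 0 (2 ^ n) + single 1 (2 ^ (2 * n))) 1) (hQ0 : Q 0 = 1)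
    (hPs : ∀ m, P (m + 1) = P m * P m +
      monomial (single 0 (2 ^ n) + single 1 (2 ^ (2 * n - m - 1))) 1 * (Q m * Q m))
    (hQs : ∀ m, Q (m + 1) = P m * Q m) (k : ℕ) (hk : k ≤ 2 ^ n) :
    realOf (single 0 (2 ^ n * k) + single 1 (2 ^ n * k ^ 2) : Fin 2 →₀ ℕ) ∈
      Set.extremePoints ℝ (convexHull ℝ (suppPts (P n))) := by
  classical
  obtain ⟨hKP, -, hRP, -⟩ := inv_of_rec n P Q hP0 hQ0 hPs hQs n le_rfl
  have h2 : 2 * n - n = n := by omega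
  rw [h2] at hKP hRP
  have hmem : realOf (single 0 (2 ^ n * k) + single 1 (2 ^ n * k ^ 2) : Fin 2 →₀ ℕ) ∈
      suppPts (P n) :=
    ⟨single 0 (2 ^ n * k) + single 1 (2 ^ n * k ^ 2), by simpa [mem_support_iff] using hKP k hk, rfl⟩
  refine Literature.Barriers.PneNP.mem_extremePoints_convexHull_of_dotProduct_lt
    (c := fun i : Fin 2 => if i = 0 then 2 * (k : ℝ) else -1) hmem ?_
  rintro q ⟨d, hd, rfl⟩ hne
  have hd' : d ∈ (P n).support := by simpa using hd
  obtain ⟨r, s, h0, h1, hrs⟩ := hRP d hd'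
  -- `(r, s) ≠ (k, k²)`
  have hne' : ¬ (r = k ∧ s = k ^ 2) := by
    rintro ⟨rfl, rfl⟩
    apply hne
    have : d = single 0 (2 ^ n * r) + single 1 (2 ^ n * r ^ 2) := by rw [eq_sv d, h0, h1]
    rw [this]
  -- the two values of the functional
  have hN : (0 : ℝ) < (2 : ℝ) ^ n := by positivity
  have hq : (fun i : Fin 2 => if i = 0 then 2 * (k : ℝ) else -1) ⬝ᵥ realOf d =
      (2 : ℝ) ^ n * (2 * k * r - s) := by
    simp [dotProduct, Fin.sum_univ_two, realOf, h0, h1]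
    ring
  have hp : (fun i : Fin 2 => if i = 0 then 2 * (k : ℝ) else -1) ⬝ᵥ
      realOf (single 0 (2 ^ n * k) + single 1 (2 ^ n * k ^ 2) : Fin 2 →₀ ℕ) =
      (2 : ℝ) ^ n * ((k : ℝ) ^ 2) := by
    simp [dotProduct, Fin.sum_univ_two, realOf]
    ring
  rw [hq, hp]
  refine mul_lt_mul_of_pos_left ?_ hN
  -- `2kr - s < k²` from `r² ≤ s` and `(r, s) ≠ (k, k²)`
  have hrs' : ((r : ℝ)) ^ 2 ≤ s := by exact_mod_cast hrs
  by_cases hrk : r = k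
  · subst hrk
    have hs : r ^ 2 + 1 ≤ s := by
      rcases Nat.lt_or_ge (r ^ 2) s with h | h
      · exact h
      · exact absurd ⟨rfl, le_antisymm h hrs⟩ hne'
    have hs' : ((r : ℝ)) ^ 2 + 1 ≤ s := by exact_mod_cast hs
    nlinarith
  · have hd1 : (1 : ℝ) ≤ ((r : ℝ) - k) ^ 2 := by
      have hz : (1 : ℤ) ≤ ((r : ℤ) - k) ^ 2 := by
        have hne0 : ((r : ℤ) - k) ≠ 0 := by
          intro h
          exact hrk (by exact_mod_cast (sub_eq_zero.1 h))
        nlinarith [sq_nonneg ((r : ℤ) - k), Int.one_le_abs hne0, sq_abs ((r : ℤ) - k)]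
      exact_mod_cast hz
    nlinarith

/-- ★ **the Newton polygon of `P_n` has at least `2^n + 1` vertices.**
[cite: HrubesYehudayoff2021, Thm 30] -/
theorem vertices_of_rec (n : ℕ) (P Q : ℕ → MvPolynomial (Fin 2) ℝ≥0)
    (hP0 : P 0 = 1 + monomial (single 0 (2 ^ n) + single 1 (2 ^ (2 * n))) 1) (hQ0 : Q 0 = 1)
    (hPs : ∀ m, P (m + 1) = P m * P m +
      monomial (single 0 (2 ^ n) + single 1 (2 ^ (2 * n - m - 1))) 1 * (Q m * Q m))
    (hQs : ∀ m, Q (m + 1) = P m * Q m) :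
    2 ^ n + 1 ≤ (Set.extremePoints ℝ (convexHull ℝ (suppPts (P n)))).ncard := by
  classical
  set key : ℕ → (Fin 2 → ℝ) :=
    fun k => realOf (single 0 (2 ^ n * k) + single 1 (2 ^ n * k ^ 2) : Fin 2 →₀ ℕ) with hkey
  have hinj : Function.Injective key := by
    intro k k' h
    have h0 := congrFun h 0
    simp only [hkey, realOf, sv_zero, Nat.cast_mul, Nat.cast_pow, Nat.cast_ofNat] at h0
    have hN : (0 : ℝ) < (2 : ℝ) ^ n := by positivity
    have : (k : ℝ) = k' := mul_left_cancel₀ hN.ne' h0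
    exact_mod_cast this
  set F : Finset (Fin 2 → ℝ) := (Finset.range (2 ^ n + 1)).image key with hF
  have hcard : F.card = 2 ^ n + 1 := by
    rw [hF, Finset.card_image_of_injective _ hinj, Finset.card_range]
  have hsub : (F : Set (Fin 2 → ℝ)) ⊆ Set.extremePoints ℝ (convexHull ℝ (suppPts (P n))) := by
    intro p hp
    obtain ⟨k, hk, rfl⟩ := Finset.mem_image.1 (Finset.mem_coe.1 hp)
    exact key_mem_extremePoints_of_rec n P Q hP0 hQ0 hPs hQs k
      (by simpa [Nat.lt_succ_iff] using Finset.mem_range.1 hk)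
  have hfin : (Set.extremePoints ℝ (convexHull ℝ (suppPts (P n)))).Finite := by
    refine Set.Finite.subset ?_ extremePoints_convexHull_subset
    exact (Finset.finite_toSet _).image _
  rw [← hcard, ← Set.ncard_coe_finset]
  exact Set.ncard_le_ncard hsub hfin

end Summit.ValiantsHypothesis.ValiantsHypothesis.Theorems.FifoMatching.NNDivisionHard.ShadowCap

end
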